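import Summits.Ventures.PercRepro.RankLevelSetLocalSparse
import Summits.Ventures.PercRepro.RankLevelSetCoreSparse

/-!
# PercRepro — planes of the `e`-free core have at most `6` points, coloops allowed (night-1, gen 3)

`proofs/NIGHT-1-C025-induction.md` §14.16 remark. Local sparsity gives `≤ 7` points to a rank-`3` set of the `e`-free
core; the Fano configuration is excluded by the COVER ARGUMENT (night-3's `card_le_six_of_core` for the coloop-free
`Core`, here in Set form with coloops allowed, as the lead's (rz)(2) reading allows): in a 7-point rank-3 set `F`,
every `x ∈ F` has `F ∖ {x}` covered by two sides of rank `≤ 2`, i.e. two disjoint 3-point lines; fixing one such line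
`L`, every `x ∉ L` has `L` as one of its sides (a side sharing two points with `L` is `L`), so every 3-subset of the
4-set `F ∖ L` has rank `≤ 2`, hence `F ∖ L` has rank `≤ 2` (submodularity) and 4 points — impossible.

* **`exists_two_sides_of_free`** — the two sides of rank `≤ k − 1` inside a set of rank `≤ k`;
* **`two_le_eRk_of_two_le_ncard_of_free`** — two points have rank `≥ 2` (no parallel pairs on the core);
* **`ncard_le_six_of_eRk_le_three_of_free`** — the plane bound;
* **`ncard_le_two_mul_add_one_of_free`** — the cover recursion `f(k + 1) ≤ 2 f(k) + 1` in general, and its instances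
  `ncard_le_thirteen_of_eRk_le_four_of_free`, `ncard_le_twentyseven_of_eRk_le_five_of_free`,
  `ncard_le_fiftyfive_of_eRk_le_six_of_free`, `ncard_le_of_eRank_le_seven_of_free` (the rank-7 core — the `(7, 3)` cell —
  lives on at most 111 elements).
Axioms: standard.
-/

open scoped Matroid

namespace PercRepro

namespace ThmN

open Set

variable {α : Type}

/-- **The two sides**: in a finite matroid with `e`-free partitions, a set `F ⊆ E` of rank `≤ k + 1` and a point
`x ∈ F` give `S, T ⊆ F ∖ {x}` covering `F ∖ {x}`, disjoint, each of rank `≤ k`. -/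
theorem exists_two_sides_of_free (M : Matroid α) [M.Finite]
    (hfree : ∀ e ∈ M.E, ∃ A ⊆ M.E \ {e}, e ∉ M.closure A ∧ e ∉ M.closure ((M.E \ {e}) \ A))
    {F : Set α} (hF : F ⊆ M.E) {k : ℕ} (hr : M.eRk F ≤ k + 1) {x : α} (hx : x ∈ F) :
    ∃ S T : Set α, S ⊆ F \ {x} ∧ T ⊆ F \ {x} ∧ F \ {x} ⊆ S ∪ T ∧ Disjoint S T ∧ M.eRk S ≤ k ∧ M.eRk T ≤ k := by
  have hxE : x ∈ M.E := hF hx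
  obtain ⟨A, hA, hxA, hxB⟩ := hfree x hxE
  have hside : ∀ Y ⊆ F, x ∉ M.closure Y → M.eRk Y ≤ k := by
    intro Y hY hxY
    have h1 : M.eRk (insert x Y) = M.eRk Y + 1 := Matroid.eRk_insert_eq_add_one ⟨hxE, hxY⟩
    have h2 : M.eRk (insert x Y) ≤ M.eRk F := M.eRk_mono (Set.insert_subset hx hY)
    have h3 : M.eRk Y + 1 ≤ (k : ℕ∞) + 1 := by
      rw [← h1]
      refine h2.trans ?_
      have : ((k + 1 : ℕ) : ℕ∞) = (k : ℕ∞) + 1 := by push_cast; rfl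
      rw [← this]; exact hr
    exact (ENat.add_le_add_iff_right (by simp)).1 h3
  refine ⟨A ∩ (F \ {x}), ((M.E \ {x}) \ A) ∩ (F \ {x}), Set.inter_subset_right, Set.inter_subset_right, ?_, ?_, ?_, ?_⟩
  · intro y hy
    by_cases hyA : y ∈ A
    · exact Or.inl ⟨hyA, hy⟩
    · exact Or.inr ⟨⟨⟨hF hy.1, hy.2⟩, hyA⟩, hy⟩
  · exact Set.disjoint_of_subset Set.inter_subset_left Set.inter_subset_left Set.disjoint_sdiff_right
  · exact hside _ (Set.inter_subset_right.trans Set.sdiff_subset)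
      (fun h => hxA (M.closure_subset_closure Set.inter_subset_left h))
  · exact hside _ (Set.inter_subset_right.trans Set.sdiff_subset)
      (fun h => hxB (M.closure_subset_closure Set.inter_subset_left h))

/-- **Two points have rank `≥ 2`** on the `e`-free core (a set of rank `≤ 1` has `≤ 1` point). -/
theorem two_le_eRk_of_two_le_ncard_of_free (M : Matroid α) [M.Finite]
    (hfree : ∀ e ∈ M.E, ∃ A ⊆ M.E \ {e}, e ∉ M.closure A ∧ e ∉ M.closure ((M.E \ {e}) \ A))
    {X : Set α} (hX : X ⊆ M.E) (h2 : 2 ≤ X.ncard) : (2 : ℕ∞) ≤ M.eRk X := by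
  by_contra hlt
  push Not at hlt
  have h2 : M.eRk X < (1 : ℕ∞) + 1 := by
    rw [show ((1 : ℕ∞) + 1) = 2 by norm_num]; exact hlt
  have h1 : M.eRk X ≤ ((1 : ℕ) : ℕ∞) := by simpa using Order.le_of_lt_add_one h2
  have := ncard_add_one_le_two_pow_of_eRk_le M (not_isLoop_of_free M hfree) hfree 1 X hX h1
  omega

/-- **Planes of the `e`-free core have at most 6 points** (coloops allowed). -/
theorem ncard_le_six_of_eRk_le_three_of_free (M : Matroid α) [M.Finite]
    (hfree : ∀ e ∈ M.E, ∃ A ⊆ M.E \ {e}, e ∉ M.closure A ∧ e ∉ M.closure ((M.E \ {e}) \ A))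
    {F : Set α} (hF : F ⊆ M.E) (hr : M.eRk F ≤ 3) : F.ncard ≤ 6 := by
  classical
  have hL := not_isLoop_of_free M hfree
  have hFfin : F.Finite := M.ground_finite.subset hF
  -- local sparsity at ranks 2 and 3
  have hLS2 : ∀ X ⊆ M.E, M.eRk X ≤ 2 → X.ncard ≤ 3 := by
    intro X hX h
    have := ncard_add_one_le_two_pow_of_eRk_le M hL hfree 2 X hX h
    omega
  have hLS3 : F.ncard ≤ 7 := by
    have := ncard_add_one_le_two_pow_of_eRk_le M hL hfree 3 F hF hr
    omega
  by_contra hlt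
  push Not at hlt
  have h7 : F.ncard = 7 := by omega
  -- the sides of a point `x ∈ F` are two disjoint 3-point sets of rank `≤ 2` covering `F ∖ {x}`
  have hsides : ∀ x ∈ F, ∃ S T : Set α, S ⊆ F \ {x} ∧ T ⊆ F \ {x} ∧ F \ {x} ⊆ S ∪ T ∧ Disjoint S T ∧
      M.eRk S ≤ 2 ∧ M.eRk T ≤ 2 ∧ S.ncard = 3 ∧ T.ncard = 3 := by
    intro x hx
    obtain ⟨S, T, hS, hT, hcov, hdisj, hrS, hrT⟩ := exists_two_sides_of_free M hfree hF (k := 2) hr hx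
    have hSfin : S.Finite := hFfin.subset (hS.trans Set.sdiff_subset)
    have hTfin : T.Finite := hFfin.subset (hT.trans Set.sdiff_subset)
    have hS3 : S.ncard ≤ 3 := hLS2 S (hS.trans (Set.sdiff_subset.trans hF)) hrS
    have hT3 : T.ncard ≤ 3 := hLS2 T (hT.trans (Set.sdiff_subset.trans hF)) hrT
    have h6 : (F \ {x}).ncard = 6 := by
      have := Set.ncard_sdiff_singleton_add_one hx hFfin
      omega
    have hcard : (F \ {x}).ncard ≤ S.ncard + T.ncard :=
      (Set.ncard_le_ncard hcov (hSfin.union hTfin)).trans (Set.ncard_union_le S T)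
    exact ⟨S, T, hS, hT, hcov, hdisj, hrS, hrT, by omega, by omega⟩
  -- fix `x₀` and the line `L := S₀`
  obtain ⟨x₀, hx₀⟩ : F.Nonempty := by
    rw [Set.nonempty_iff_ne_empty]; rintro rfl; simp at h7
  obtain ⟨L, T₀, hL₀, -, -, -, hrL, -, hL3, -⟩ := hsides x₀ hx₀
  have hLF : L ⊆ F := hL₀.trans Set.sdiff_subset
  have hLE : L ⊆ M.E := hLF.trans hF
  have hLfin : L.Finite := hFfin.subset hLF
  set Q := F \ L with hQ
  have hQF : Q ⊆ F := Set.sdiff_subset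
  have hQE : Q ⊆ M.E := hQF.trans hF
  have hQfin : Q.Finite := hFfin.subset hQF
  have hQ4 : Q.ncard = 4 := by
    have : Q.ncard + L.ncard = F.ncard := by rw [hQ]; exact Set.ncard_sdiff_add_ncard_of_subset hLF hFfin
    omega
  -- every 3-subset `Q ∖ {x}` of `Q` has rank `≤ 2`
  have hQx : ∀ x ∈ Q, M.eRk (Q \ {x}) ≤ 2 := by
    intro x hxQ
    have hxF : x ∈ F := hxQ.1
    have hxL : x ∉ L := hxQ.2
    obtain ⟨S, T, hS, hT, hcov, hdisj, hrS, hrT, hS3, hT3⟩ := hsides x hxF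
    have hSfin : S.Finite := hFfin.subset (hS.trans Set.sdiff_subset)
    have hTfin : T.Finite := hFfin.subset (hT.trans Set.sdiff_subset)
    have hLx : L ⊆ F \ {x} := fun y hy => ⟨hLF hy, fun h => hxL (h ▸ hy)⟩
    -- a side sharing two points with `L` is `L`
    have hmerge : ∀ S' : Set α, S' ⊆ F \ {x} → M.eRk S' ≤ 2 → S'.ncard = 3 → 2 ≤ (L ∩ S').ncard → S' = L := by
      intro S' hS' hrS' hS'3 h2
      have hS'fin : S'.Finite := hFfin.subset (hS'.trans Set.sdiff_subset)
      have hS'E : S' ⊆ M.E := hS'.trans (Set.sdiff_subset.trans hF)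
      have hint : (2 : ℕ∞) ≤ M.eRk (L ∩ S') :=
        two_le_eRk_of_two_le_ncard_of_free M hfree (Set.inter_subset_left.trans hLE) h2
      have hsub := M.eRk_inter_add_eRk_union_le L S'
      have hun : M.eRk (L ∪ S') ≤ 2 := by
        have h4 : M.eRk (L ∩ S') + M.eRk (L ∪ S') ≤ (2 : ℕ∞) + 2 :=
          hsub.trans (add_le_add hrL hrS')
        have h5 : (2 : ℕ∞) + M.eRk (L ∪ S') ≤ 2 + 2 := by
          calc (2 : ℕ∞) + M.eRk (L ∪ S') ≤ M.eRk (L ∩ S') + M.eRk (L ∪ S') := by gcongr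
            _ ≤ 2 + 2 := h4
        exact (ENat.add_le_add_iff_left (by simp)).1 h5
      have hun3 : (L ∪ S').ncard ≤ 3 := hLS2 _ (Set.union_subset hLE hS'E) hun
      have hLeq : L ∪ S' = L := by
        apply (Set.eq_of_subset_of_ncard_le Set.subset_union_left ?_ (hLfin.union hS'fin)).symm
        omega
      have hS'L : S' ⊆ L := by rw [← hLeq]; exact Set.subset_union_right
      exact Set.eq_of_subset_of_ncard_le hS'L (by omega) hLfin
    -- `L` is one of the two sides
    have hcount : 3 ≤ (L ∩ S).ncard + (L ∩ T).ncard := by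
      have hsplit : L ⊆ (L ∩ S) ∪ (L ∩ T) := by
        intro y hy
        rcases hcov (hLx hy) with h | h
        · exact Or.inl ⟨hy, h⟩
        · exact Or.inr ⟨hy, h⟩
      calc 3 = L.ncard := hL3.symm
        _ ≤ ((L ∩ S) ∪ (L ∩ T)).ncard :=
            Set.ncard_le_ncard hsplit ((hLfin.subset Set.inter_subset_left).union (hLfin.subset Set.inter_subset_left))
        _ ≤ (L ∩ S).ncard + (L ∩ T).ncard := Set.ncard_union_le _ _
    have hother : ∃ T' : Set α, T' ⊆ F \ {x} ∧ M.eRk T' ≤ 2 ∧ F \ {x} ⊆ L ∪ T' := by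
      rcases Nat.lt_or_ge (L ∩ S).ncard 2 with h | h
      · have hTL : T = L := hmerge T hT hrT hT3 (by omega)
        exact ⟨S, hS, hrS, by rw [← hTL, Set.union_comm]; exact hcov⟩
      · have hSL : S = L := hmerge S hS hrS hS3 h
        exact ⟨T, hT, hrT, by rw [← hSL]; exact hcov⟩
    obtain ⟨T', -, hrT', hcov'⟩ := hother
    have hQT' : Q \ {x} ⊆ T' := by
      intro y hy
      have hyFx : y ∈ F \ {x} := ⟨hy.1.1, hy.2⟩
      rcases hcov' hyFx with h | h
      · exact absurd h hy.1.2
      · exact h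
    exact (M.eRk_mono hQT').trans hrT'
  -- hence `Q` has rank `≤ 2`, contradicting its 4 points
  obtain ⟨a, ha, b, hb, hab⟩ : ∃ a ∈ Q, ∃ b ∈ Q, a ≠ b := by
    have : 1 < Q.ncard := by omega
    obtain ⟨a, ha⟩ : Q.Nonempty := by
      rw [Set.nonempty_iff_ne_empty]; intro h; rw [h] at hQ4; simp at hQ4
    obtain ⟨b, hb, hba⟩ := Set.exists_ne_of_one_lt_ncard this a
    exact ⟨a, ha, b, hb, hba.symm⟩
  have hQa := hQx a ha
  have hQb := hQx b hb
  have hint2 : (2 : ℕ∞) ≤ M.eRk ((Q \ {a}) ∩ (Q \ {b})) := by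
    refine two_le_eRk_of_two_le_ncard_of_free M hfree (Set.inter_subset_left.trans (Set.sdiff_subset.trans hQE)) ?_
    have heq : (Q \ {a}) ∩ (Q \ {b}) = Q \ {a, b} := by
      ext y; simp only [Set.mem_inter_iff, Set.mem_sdiff, Set.mem_singleton_iff, Set.mem_insert_iff]; tauto
    rw [heq]
    have hab' : ({a, b} : Set α) ⊆ Q := by
      intro y hy; rcases hy with rfl | rfl; exact ha; exact hb
    have := Set.ncard_sdiff_add_ncard_of_subset hab' hQfin
    rw [Set.ncard_pair hab] at this
    omega
  have hunion : (Q \ {a}) ∪ (Q \ {b}) = Q := by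
    ext y; simp only [Set.mem_union, Set.mem_sdiff, Set.mem_singleton_iff]
    constructor
    · rintro (h | h) <;> exact h.1
    · intro hy
      by_cases hya : y = a
      · exact Or.inr ⟨hy, by rw [hya]; exact hab⟩
      · exact Or.inl ⟨hy, hya⟩
  have hsub := M.eRk_inter_add_eRk_union_le (Q \ {a}) (Q \ {b})
  rw [hunion] at hsub
  have hQ2 : M.eRk Q ≤ 2 := by
    have h4 : M.eRk ((Q \ {a}) ∩ (Q \ {b})) + M.eRk Q ≤ (2 : ℕ∞) + 2 := hsub.trans (add_le_add hQa hQb)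
    have h5 : (2 : ℕ∞) + M.eRk Q ≤ 2 + 2 := by
      calc (2 : ℕ∞) + M.eRk Q ≤ M.eRk ((Q \ {a}) ∩ (Q \ {b})) + M.eRk Q := by gcongr
        _ ≤ 2 + 2 := h4
    exact (ENat.add_le_add_iff_left (by simp)).1 h5
  have := hLS2 Q hQE hQ2
  omega

/-- **The cover recursion**: if every set of rank `≤ k` of the `e`-free core has `≤ B` points, every set of rank
`≤ k + 1` has `≤ 2B + 1` points (`{x}` and the two sides). -/
theorem ncard_le_two_mul_add_one_of_free (M : Matroid α) [M.Finite]
    (hfree : ∀ e ∈ M.E, ∃ A ⊆ M.E \ {e}, e ∉ M.closure A ∧ e ∉ M.closure ((M.E \ {e}) \ A))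
    {k B : ℕ} (hB : ∀ Y ⊆ M.E, M.eRk Y ≤ k → Y.ncard ≤ B) :
    ∀ X ⊆ M.E, M.eRk X ≤ k + 1 → X.ncard ≤ 2 * B + 1 := by
  intro X hX hr
  rcases X.eq_empty_or_nonempty with hemp | ⟨x, hx⟩
  · rw [hemp, Set.ncard_empty]; omega
  obtain ⟨S, T, hS, hT, hcov, -, hrS, hrT⟩ := exists_two_sides_of_free M hfree hX hr hx
  have hXfin : X.Finite := M.ground_finite.subset hX
  have hSfin : S.Finite := hXfin.subset (hS.trans Set.sdiff_subset)
  have hTfin : T.Finite := hXfin.subset (hT.trans Set.sdiff_subset)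
  have hSB := hB S (hS.trans (Set.sdiff_subset.trans hX)) hrS
  have hTB := hB T (hT.trans (Set.sdiff_subset.trans hX)) hrT
  have h1 : (X \ {x}).ncard + 1 = X.ncard := Set.ncard_sdiff_singleton_add_one hx hXfin
  have h2 : (X \ {x}).ncard ≤ S.ncard + T.ncard :=
    (Set.ncard_le_ncard hcov (hSfin.union hTfin)).trans (Set.ncard_union_le S T)
  omega

/-- Rank-`4` sets of the `e`-free core have at most `13` points. -/
theorem ncard_le_thirteen_of_eRk_le_four_of_free (M : Matroid α) [M.Finite]
    (hfree : ∀ e ∈ M.E, ∃ A ⊆ M.E \ {e}, e ∉ M.closure A ∧ e ∉ M.closure ((M.E \ {e}) \ A))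
    {F : Set α} (hF : F ⊆ M.E) (hr : M.eRk F ≤ 4) : F.ncard ≤ 13 :=
  ncard_le_two_mul_add_one_of_free M hfree (k := 3) (B := 6)
    (fun _ hY hrY => ncard_le_six_of_eRk_le_three_of_free M hfree hY hrY) F hF hr

/-- Rank-`5` sets of the `e`-free core have at most `27` points. -/
theorem ncard_le_twentyseven_of_eRk_le_five_of_free (M : Matroid α) [M.Finite]
    (hfree : ∀ e ∈ M.E, ∃ A ⊆ M.E \ {e}, e ∉ M.closure A ∧ e ∉ M.closure ((M.E \ {e}) \ A))
    {F : Set α} (hF : F ⊆ M.E) (hr : M.eRk F ≤ 5) : F.ncard ≤ 27 :=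
  ncard_le_two_mul_add_one_of_free M hfree (k := 4) (B := 13)
    (fun _ hY hrY => ncard_le_thirteen_of_eRk_le_four_of_free M hfree hY hrY) F hF hr

/-- Rank-`6` sets of the `e`-free core have at most `55` points. -/
theorem ncard_le_fiftyfive_of_eRk_le_six_of_free (M : Matroid α) [M.Finite]
    (hfree : ∀ e ∈ M.E, ∃ A ⊆ M.E \ {e}, e ∉ M.closure A ∧ e ∉ M.closure ((M.E \ {e}) \ A))
    {F : Set α} (hF : F ⊆ M.E) (hr : M.eRk F ≤ 6) : F.ncard ≤ 55 :=
  ncard_le_two_mul_add_one_of_free M hfree (k := 5) (B := 27)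
    (fun _ hY hrY => ncard_le_twentyseven_of_eRk_le_five_of_free M hfree hY hrY) F hF hr

/-- **The rank-`7` `e`-free core lives on at most `111` elements** (the `(7, 3)` cell is a finite family). -/
theorem ncard_le_of_eRank_le_seven_of_free (M : Matroid α) [M.Finite]
    (hfree : ∀ e ∈ M.E, ∃ A ⊆ M.E \ {e}, e ∉ M.closure A ∧ e ∉ M.closure ((M.E \ {e}) \ A))
    (hR : M.eRank ≤ 7) : M.E.ncard ≤ 111 :=
  ncard_le_two_mul_add_one_of_free M hfree (k := 6) (B := 55)
    (fun _ hY hrY => ncard_le_fiftyfive_of_eRk_le_six_of_free M hfree hY hrY) M.E subset_rfl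
    (by rw [← M.eRank_def]; exact hR)

/-- **The sharpened local sparsity at every rank `≥ 3`**: a set of rank `≤ k + 3` of the `e`-free core has at most
`7·2^k − 1` points (induction on `k` from the plane bound by the cover recursion). -/
theorem ncard_add_one_le_seven_mul_two_pow_of_free (M : Matroid α) [M.Finite]
    (hfree : ∀ e ∈ M.E, ∃ A ⊆ M.E \ {e}, e ∉ M.closure A ∧ e ∉ M.closure ((M.E \ {e}) \ A)) (k : ℕ) :
    ∀ X ⊆ M.E, M.eRk X ≤ k + 3 → X.ncard + 1 ≤ 7 * 2 ^ k := by
  induction k with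
  | zero =>
    intro X hX hr
    have := ncard_le_six_of_eRk_le_three_of_free M hfree hX (by simpa using hr)
    omega
  | succ k ih =>
    intro X hX hr
    have hB : ∀ Y ⊆ M.E, M.eRk Y ≤ k + 3 → Y.ncard ≤ 7 * 2 ^ k - 1 := by
      intro Y hY hrY
      have := ih Y hY hrY
      omega
    have hr' : M.eRk X ≤ ((k + 3 : ℕ) : ℕ∞) + 1 := by
      have h : ((k + 3 : ℕ) : ℕ∞) + 1 = ((k + 1 : ℕ) : ℕ∞) + 3 := by push_cast; ring
      rw [h]; exact hr
    have := ncard_le_two_mul_add_one_of_free M hfree (k := k + 3) (B := 7 * 2 ^ k - 1) hB X hX hr'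
    have h2 : 7 * 2 ^ (k + 1) = 2 * (7 * 2 ^ k) := by ring
    have h3 : 1 ≤ 7 * 2 ^ k := by have := Nat.one_le_two_pow (n := k); omega
    omega

/-- **The `e`-free core of rank `p ≥ 3` has at most `7·2^{p−3} − 1` elements**. -/
theorem ncard_ground_add_one_le_seven_mul_two_pow_of_free (M : Matroid α) [M.Finite]
    (hfree : ∀ e ∈ M.E, ∃ A ⊆ M.E \ {e}, e ∉ M.closure A ∧ e ∉ M.closure ((M.E \ {e}) \ A))
    {p : ℕ} (hp : 3 ≤ p) (hR : M.eRank ≤ p) : M.E.ncard + 1 ≤ 7 * 2 ^ (p - 3) :=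
  ncard_add_one_le_seven_mul_two_pow_of_free M hfree (p - 3) M.E subset_rfl (by
    rw [← M.eRank_def]
    have h : ((p - 3 : ℕ) : ℕ∞) + 3 = (p : ℕ∞) := by
      rw [show (3 : ℕ∞) = ((3 : ℕ) : ℕ∞) by rfl, ← Nat.cast_add, show p - 3 + 3 = p by omega]
    rw [h]; exact hR)

end ThmN

end PercRepro
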